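import Literature.Probability.LatticeModels.FKIsingInterfaceTightness
import Literature.Probability.LatticeModels.MedialTraversalSectors
import Literature.Probability.LatticeModels.Sweep1PassageProofs
import Literature.Probability.LatticeModels.FKIsingAnnulusCrossingRSW
import HarnessLib

/-!
# The interface traversal bound (C1) for the critical FK-Ising interface, from Lemma 6.3

Topic `Literature/Probability/LatticeModels` (trunk `StatMech`, family `crit-ising`). We prove
the named fact `fkInterface_traversalBound` of `FKIsingInterfaceTightness.lean` (the
Aizenman–Burchard hypothesis (H1) for the FK-Ising exploration polygon, DCS 2012 Thm. 6.1 /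
eq. (6.2)) from the one remaining analytic input, the annulus-circuit estimate
`fkIsing_annulusCrossing_le` (DCS 2012, Lemma 6.3, itself a consequence of the RSW bound
`fkIsing_rsw`): `fkInterface_traversalBound_of_annulusCrossing_le`.

The proof follows Duminil-Copin–Smirnov, Clay Math. Proc. 15 (2012), §6.1, pp. 27, in the
one-sided form dictated by the absence of a BK inequality for FK percolation:

1. (`MedialTraversalSectors.fkArms_of_hasTraversals`, deterministic.) If the exploration
   polygon traverses the round shell `D(x; ρ, R)` `2(j + N)` times (`N = N(ρ)` bounds the
   boundary points of the domain separated in the annulus), the configuration contains `j` open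
   arms across the square band of lattice levels `[nᵢ, nₒ]` about the site `x₀` nearest to `x`,
   in pairwise distinct local clusters of the band, none locally joined to the wired arc.
2. (`RandomClusterMultiCrossing` + `RandomClusterRegionCrossingBound`, probabilistic.) Under the
   random-cluster measure of the interface graph wired on the arc `A` — which is the law
   `fkDobrushinMeasure` read on the graph (`fkDobrushinMeasure_real_eq`) — `j` such arms cost
   `(c^m)^j`, where `m ≍ log₃ (R/ρ)` disjoint square annuli `x₀ + S_{n,2n}` fit in the band and
   `c < 1` bounds the wired crossing probability of one annulus (Lemma 6.3): successive
   conditioning on the local clusters (domain Markov + comparison between boundary conditions).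
3. Choosing `j` with `c^j ≤ 3⁻³` gives `P ≤ K (ρ/R)^3`.

The threshold `k(x, ρ, R) = 2(j + N(ρ))` depends on the shell only through the modulus of
continuity of `∂D` at scale `ρ` (DCS's proviso on boundary bookkeeping, see the docstring of the
fact). Everything here is proved; the only hypothesis is the named fact
`fkIsing_annulusCrossing_le`.

## References

* H. Duminil-Copin, S. Smirnov, *Conformal invariance of lattice models*, Clay Math. Proc. 15
  (2012), Thm. 6.1 (proof, eq. (6.1)–(6.2)), Lemma 6.3. [DuminilCopinSmirnov2012Clay]
* M. Aizenman, A. Burchard, *Hölder regularity and dimension bounds for random curves*, Duke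
  Math. J. 99 (1999), §1.b (1.3), Appendix A. [AizenmanBurchardDuke1999]
* G. Grimmett, *The Random-Cluster Model*, Springer (2006), Lemma (4.13), (4.14). [Grimmett2006]
-/

noncomputable section

open MeasureTheory Metric Set Filter Topology
open scoped unitInterval ENNReal
open Literature.Probability.Percolation

namespace Literature.Probability.LatticeModels

/-! ### The self-dual point is strictly below one -/

/-- `p_sd = √2/(1+√2) < 1`. [folklore] -/
theorem criticalFKIsingParam_lt_one : criticalFKIsingParam < 1 := by
  unfold criticalFKIsingParam
  have h2 : 0 < Real.sqrt 2 := Real.sqrt_pos.2 two_pos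
  rw [div_lt_one (by linarith)]
  linarith

/-! ### Lattice levels about the site nearest to a point -/

/-- The lattice site `⌊x/δ⌋` (coordinatewise). [folklore] -/
def nearSite (δ : ℝ) (x : ℂ) : Site 2 := fun k ↦ ⌊coordVec x k / δ⌋

/-- Coordinates of a mesh point. [folklore] -/
theorem coordVec_meshPoint (δ : ℝ) (z : Site 2) (k : Fin 2) : coordVec (meshPoint δ z) k = δ * z k := by
  rcases fin_two_eq_zero_or_one k with rfl | rfl <;> simp [meshPoint, Site.toComplex]

/-- The mesh point of `nearSite δ x` is within `δ` of `x` in each coordinate. [folklore] -/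
theorem abs_nearSite_sub_le {δ : ℝ} (hδ : 0 < δ) (x : ℂ) (k : Fin 2) :
    |δ * (nearSite δ x k : ℝ) - coordVec x k| ≤ δ := by
  unfold nearSite
  have h1 := Int.floor_le (coordVec x k / δ)
  have h2 := Int.lt_floor_add_one (coordVec x k / δ)
  rw [abs_le]
  constructor
  · have : δ * ((⌊coordVec x k / δ⌋ : ℝ) + 1) > coordVec x k := by
      rw [gt_iff_lt, ← div_lt_iff₀' hδ]; exact h2
    nlinarith
  · have : δ * (⌊coordVec x k / δ⌋ : ℝ) ≤ coordVec x k := by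
      rw [← le_div_iff₀' hδ]; exact h1
    linarith

/-- A coordinate difference is at most the distance. [folklore] -/
theorem abs_coordVec_sub_le_dist (z w : ℂ) (k : Fin 2) : |coordVec z k - coordVec w k| ≤ dist z w := by
  rw [Complex.dist_eq]
  rcases fin_two_eq_zero_or_one k with rfl | rfl
  · simpa using Complex.abs_re_le_norm (z - w)
  · simpa using Complex.abs_im_le_norm (z - w)

/-- The distance is at most the sum of the coordinate differences. [folklore] -/
theorem dist_le_abs_add_abs (z w : ℂ) : dist z w ≤ |coordVec z 0 - coordVec w 0| + |coordVec z 1 - coordVec w 1| := by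
  rw [Complex.dist_eq]
  simpa using Complex.norm_le_abs_re_add_abs_im (z - w)

/-- **Level versus distance, lower bound**: `δ · supLevel x₀ z ≤ dist (δz, x) + δ` for the
nearest site `x₀` of `x`. [folklore] -/
theorem mul_supLevel_le_dist_add {δ : ℝ} (hδ : 0 < δ) (x : ℂ) (z : Site 2) :
    δ * supLevel (nearSite δ x) z ≤ dist (meshPoint δ z) x + δ := by
  have key : ∀ k : Fin 2, δ * |((z - nearSite δ x) k : ℝ)| ≤ dist (meshPoint δ z) x + δ := by
    intro k
    rw [Pi.sub_apply, Int.cast_sub, ← abs_of_pos hδ, ← abs_mul, abs_of_pos hδ, mul_sub]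
    have h1 := abs_nearSite_sub_le hδ x k
    have h2 := abs_coordVec_sub_le_dist (meshPoint δ z) x k
    rw [coordVec_meshPoint] at h2
    calc |δ * (z k : ℝ) - δ * (nearSite δ x k : ℝ)|
        = |(δ * (z k : ℝ) - coordVec x k) - (δ * (nearSite δ x k : ℝ) - coordVec x k)| := by ring_nf
      _ ≤ |δ * (z k : ℝ) - coordVec x k| + |δ * (nearSite δ x k : ℝ) - coordVec x k| := abs_sub _ _
      _ ≤ dist (meshPoint δ z) x + δ := by linarith
  unfold supLevel
  have h0 := key 0; have h1 := key 1
  have hcast : ((max |(z - nearSite δ x) 0| |(z - nearSite δ x) 1| : ℤ) : ℝ) =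
      max |((z - nearSite δ x) 0 : ℝ)| |((z - nearSite δ x) 1 : ℝ)| := by push_cast; rfl
  rw [hcast]
  rcases le_total |((z - nearSite δ x) 0 : ℝ)| |((z - nearSite δ x) 1 : ℝ)| with h | h
  · rw [max_eq_right h]; exact h1
  · rw [max_eq_left h]; exact h0

/-- **Level versus distance, upper bound**: `dist (δz, x) ≤ 2 (δ · supLevel x₀ z + δ)`. [folklore] -/
theorem dist_le_two_mul_supLevel {δ : ℝ} (hδ : 0 < δ) (x : ℂ) (z : Site 2) :
    dist (meshPoint δ z) x ≤ 2 * (δ * supLevel (nearSite δ x) z + δ) := by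
  have key : ∀ k : Fin 2, |coordVec (meshPoint δ z) k - coordVec x k| ≤ δ * supLevel (nearSite δ x) z + δ := by
    intro k
    rw [coordVec_meshPoint]
    have h1 := abs_nearSite_sub_le hδ x k
    have hlev : |((z k : ℤ) : ℝ) - (nearSite δ x k : ℝ)| ≤ supLevel (nearSite δ x) z := by
      have : |z k - nearSite δ x k| ≤ supLevel (nearSite δ x) z := by
        unfold supLevel
        rcases fin_two_eq_zero_or_one k with rfl | rfl
        · exact le_max_left _ _
        · exact le_max_right _ _
      exact_mod_cast this
    calc |δ * (z k : ℝ) - coordVec x k|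
        = |δ * ((z k : ℝ) - (nearSite δ x k : ℝ)) + (δ * (nearSite δ x k : ℝ) - coordVec x k)| := by ring_nf
      _ ≤ |δ * ((z k : ℝ) - (nearSite δ x k : ℝ))| + |δ * (nearSite δ x k : ℝ) - coordVec x k| := abs_add_le _ _
      _ ≤ δ * supLevel (nearSite δ x) z + δ := by
          rw [abs_mul, abs_of_pos hδ]
          have := mul_le_mul_of_nonneg_left hlev hδ.le
          linarith
  linarith [dist_le_abs_add_abs (meshPoint δ z) x, key 0, key 1]

/-! ### The vertices of the exploration are vertices of the domain graph -/

/-- The left vertex of a dart of the exploration is a vertex of `Ω_δ`. [cite: Smirnov2001, §2] -/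
theorem IsMedialExploration.cv_mem_meshDomain {D : DiscreteDobrushin} {ω : Percolation.BondConfig (Site 2)}
    {a : MedialVertex} {l : List MedialVertex} (hexp : IsMedialExploration D ω (a :: l)) {i : ℕ}
    (hi : i < ((a :: l).zip l).length) : hexp.cv i ∈ meshDomain D.Ω D.δ := by
  have hc := hexp.isCorner hi
  have hadj := hexp.isInnerFace hi _ _ hc (isCorner_cornerNeighbor hc 0) (adj_cornerNeighbor hc 0)
  exact (discreteDomainGraph_adj_iff.1 hadj).2.1

/-! ### From band arms in `ℤ²` to the arm event of the interface graph -/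

section Transfer

variable {E : DiscreteDobrushin}

/-- Adjacency in the interface graph, unfolded: an edge of `Ω_δ` with no endpoint on the arc `B`.
[cite: Smirnov2010, §2.1] -/
theorem interfaceGraph_adj_iff {u w : meshDomain E.Ω E.δ} :
    E.interfaceGraph.Adj u w ↔ (discreteDomainGraph E.Ω E.δ).Adj u.1 w.1 ∧ u.1 ∉ E.zdArcB ∧ w.1 ∉ E.zdArcB := by
  rw [DiscreteDobrushin.interfaceGraph, SimpleGraph.deleteEdges_adj, domainSubgraph, SimpleGraph.comap_adj]
  simp only [Set.mem_setOf_eq, Sym2.mem_iff, not_exists, not_and]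
  constructor
  · rintro ⟨h, h'⟩
    exact ⟨h, fun hu ↦ h' u (Or.inl rfl) hu, fun hw ↦ h' w (Or.inr rfl) hw⟩
  · rintro ⟨h, hu, hw⟩
    refine ⟨h, ?_⟩
    rintro v (rfl | rfl)
    · exact hu
    · exact hw

/-- An edge of the interface graph open in `η` is open in the lifted configuration and in its
completion, and is a lattice edge. [cite: Smirnov2010, §2.1] -/
theorem mem_bcBondConfig_liftConfig {η : Finset (Sym2 (meshDomain E.Ω E.δ))} {u w : meshDomain E.Ω E.δ}
    (hadj : E.interfaceGraph.Adj u w) (hmem : s(u, w) ∈ η) :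
    s(u.1, w.1) ∈ liftConfig E.Ω E.δ η ∧ s(u.1, w.1) ∈ E.bcBondConfig (liftConfig E.Ω E.δ η) ∧
      (zdGraph 2).Adj u.1 w.1 := by
  have hlift : s(u.1, w.1) ∈ liftConfig E.Ω E.δ η :=
    DiscreteDobrushin.mem_liftConfig_iff.2 ⟨s(u, w), hmem, by simp⟩
  obtain ⟨hdom, hu, hw⟩ := interfaceGraph_adj_iff.1 hadj
  refine ⟨hlift, E.mem_bcBondConfig_iff.2 ⟨(SimpleGraph.mem_edgeSet _).2 hdom, Or.inr ⟨hlift, ?_⟩⟩,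
    interfaceGraph_adj_zdGraph E hadj⟩
  intro v hv
  rcases Sym2.mem_iff.1 hv with rfl | rfl
  · exact hu
  · exact hw

variable (E) [Fintype (meshDomain E.Ω E.δ)]

/-- The region of the band: edges of the interface graph with both endpoints at level in
`[nᵢ, nₒ]` about `x₀`. [cite: DuminilCopinSmirnov2012Clay, §6.1] -/
def bandRegion [DecidableRel E.interfaceGraph.Adj] (x₀ : Site 2) (nᵢ nₒ : ℤ) : Finset (Sym2 (meshDomain E.Ω E.δ)) :=
  E.interfaceGraph.edgeFinset.filter fun e ↦ ∀ v ∈ e, nᵢ ≤ supLevel x₀ v.1 ∧ supLevel x₀ v.1 ≤ nₒ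

/-- The sources/targets of the band: vertices at a given level. [cite: DuminilCopinSmirnov2012Clay, §6.1] -/
def bandIn (x₀ : Site 2) (n : ℤ) : Finset (meshDomain E.Ω E.δ) :=
  Finset.univ.filter fun v ↦ supLevel x₀ v.1 = n

open scoped Classical in
/-- The exceptional vertices: sites of the wired arc strictly inside the band.
[cite: DuminilCopinSmirnov2012Clay, §6.1] -/
def bandZ (x₀ : Site 2) (nᵢ nₒ : ℤ) : Finset (meshDomain E.Ω E.δ) :=
  Finset.univ.filter fun v ↦ v.1 ∈ E.zdArcA ∧ nᵢ < supLevel x₀ v.1 ∧ supLevel x₀ v.1 < nₒ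

variable {E}

/-- Membership in the band region. [folklore] -/
theorem mem_bandRegion [DecidableRel E.interfaceGraph.Adj] {x₀ : Site 2} {nᵢ nₒ : ℤ} {e : Sym2 (meshDomain E.Ω E.δ)} :
    e ∈ bandRegion E x₀ nᵢ nₒ ↔ e ∈ E.interfaceGraph.edgeFinset ∧ ∀ v ∈ e, nᵢ ≤ supLevel x₀ v.1 ∧ supLevel x₀ v.1 ≤ nₒ := by
  rw [bandRegion, Finset.mem_filter]

/-- Membership in a level set of the band. [folklore] -/
theorem mem_bandIn {x₀ : Site 2} {n : ℤ} {v : meshDomain E.Ω E.δ} : v ∈ bandIn E x₀ n ↔ supLevel x₀ v.1 = n := by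
  rw [bandIn, Finset.mem_filter]; simp

/-- Membership in the exceptional set. [folklore] -/
theorem mem_bandZ {x₀ : Site 2} {nᵢ nₒ : ℤ} {v : meshDomain E.Ω E.δ} :
    v ∈ bandZ E x₀ nᵢ nₒ ↔ v.1 ∈ E.zdArcA ∧ nᵢ < supLevel x₀ v.1 ∧ supLevel x₀ v.1 < nₒ := by
  classical
  simp [bandZ]

/-- A path of the region graph of the band on a configuration of the interface graph is a path
of the band graph of the lifted configuration. [folklore] -/
theorem bandGraph_reachable_of_regionGraph_reachable [DecidableRel E.interfaceGraph.Adj] {x₀ : Site 2} {nᵢ nₒ : ℤ}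
    {η : Finset (Sym2 (meshDomain E.Ω E.δ))} (hη : η ⊆ E.interfaceGraph.edgeFinset)
    {u w : meshDomain E.Ω E.δ}
    (h : (regionGraph (bandRegion E x₀ nᵢ nₒ) (↑η : Percolation.BondConfig (meshDomain E.Ω E.δ))).Reachable u w) :
    (bandGraph E (liftConfig E.Ω E.δ η) x₀ nᵢ nₒ).Reachable u.1 w.1 := by
  obtain ⟨p⟩ := h
  induction p with
  | nil => rfl
  | @cons a b _ hadj _ ih =>
    refine SimpleGraph.Reachable.trans (SimpleGraph.Adj.reachable ?_) ih
    obtain ⟨hmem, hU, -⟩ := regionGraph_adj.1 hadj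
    rw [Finset.mem_coe] at hmem
    obtain ⟨-, hlev⟩ := mem_bandRegion.1 hU
    have hGadj : E.interfaceGraph.Adj a b := SimpleGraph.mem_edgeFinset.1 (hη hmem)
    obtain ⟨h1, h2, h3⟩ := mem_bcBondConfig_liftConfig hGadj hmem
    exact bandGraph_adj.2 ⟨h1, h2, h3, (hlev a (Sym2.mem_mk_left _ _)).1, (hlev a (Sym2.mem_mk_left _ _)).2,
      (hlev b (Sym2.mem_mk_right _ _)).1, (hlev b (Sym2.mem_mk_right _ _)).2⟩

/-- A path of the band graph of the lifted configuration from a vertex of `Ω_δ` is a path of the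
region graph of the band. [folklore] -/
theorem regionGraph_reachable_of_bandGraph_reachable [DecidableRel E.interfaceGraph.Adj] {x₀ : Site 2} {nᵢ nₒ : ℤ}
    {η : Finset (Sym2 (meshDomain E.Ω E.δ))} (hη : η ⊆ E.interfaceGraph.edgeFinset)
    (u : meshDomain E.Ω E.δ) {w : Site 2}
    (h : (bandGraph E (liftConfig E.Ω E.δ η) x₀ nᵢ nₒ).Reachable u.1 w) :
    ∃ hw : w ∈ meshDomain E.Ω E.δ,
      (regionGraph (bandRegion E x₀ nᵢ nₒ) (↑η : Percolation.BondConfig (meshDomain E.Ω E.δ))).Reachable u ⟨w, hw⟩ := by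
  -- generalise over the start vertex
  suffices key : ∀ (a : Site 2), (bandGraph E (liftConfig E.Ω E.δ η) x₀ nᵢ nₒ).Walk a w → ∀ ha : a ∈ meshDomain E.Ω E.δ,
      ∃ hw : w ∈ meshDomain E.Ω E.δ,
        (regionGraph (bandRegion E x₀ nᵢ nₒ) (↑η : Percolation.BondConfig (meshDomain E.Ω E.δ))).Reachable ⟨a, ha⟩ ⟨w, hw⟩ by
    obtain ⟨p⟩ := h
    exact key u.1 p u.2
  clear h
  intro a p
  induction p with
  | nil => exact fun ha ↦ ⟨ha, by rfl⟩
  | @cons a b _ hadj _ ih =>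
    intro ha
    obtain ⟨hω, -, hzd, ha1, ha2, hb1, hb2⟩ := bandGraph_adj.1 hadj
    obtain ⟨e', he', hmap⟩ := DiscreteDobrushin.mem_liftConfig_iff.1 hω
    -- `e' = s(a', b')` with `{a'.1, b'.1} = {a, b}`
    induction e' using Sym2.ind with
    | h a' b' =>
      rw [Sym2.map_mk, Sym2.eq_iff] at hmap
      have hb : b ∈ meshDomain E.Ω E.δ := by
        rcases hmap with ⟨-, h⟩ | ⟨h, -⟩
        · rw [← h]; exact b'.2
        · rw [← h]; exact a'.2
      obtain ⟨hw, hreach⟩ := ih hb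
      refine ⟨hw, SimpleGraph.Reachable.trans (SimpleGraph.Adj.reachable ?_) hreach⟩
      have hedge : s((⟨a, ha⟩ : meshDomain E.Ω E.δ), ⟨b, hb⟩) = s(a', b') := by
        rcases hmap with ⟨h1, h2⟩ | ⟨h1, h2⟩
        · have e1 : a' = ⟨a, ha⟩ := Subtype.ext h1
          have e2 : b' = ⟨b, hb⟩ := Subtype.ext h2
          rw [e1, e2]
        · have e1 : a' = ⟨b, hb⟩ := Subtype.ext h1
          have e2 : b' = ⟨a, ha⟩ := Subtype.ext h2
          rw [e1, e2, Sym2.eq_swap]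
      refine regionGraph_adj.2 ⟨?_, ?_, fun h ↦ hzd.ne (congrArg Subtype.val h)⟩
      · rw [Finset.mem_coe, hedge]; exact he'
      · refine mem_bandRegion.2 ⟨by rw [hedge]; exact hη he', ?_⟩
        intro v hv
        rcases Sym2.mem_iff.1 hv with rfl | rfl
        · exact ⟨ha1, ha2⟩
        · exact ⟨hb1, hb2⟩

/-- **From the band arms of `ℤ²` to the separated-arms event of the interface graph.** The
conclusion of `fkArms_of_hasTraversals` for the lifted configuration `liftConfig η` of
`η ⊆ E(G)` puts `η` in `regionArmsAvoiding (bandRegion) (bandIn nᵢ) (bandIn nₒ) (bandZ) j`.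
[cite: DuminilCopinSmirnov2012Clay, §6.1] -/
theorem mem_regionArmsAvoiding_of_bandArms [DecidableRel E.interfaceGraph.Adj] {x₀ : Site 2} {nᵢ nₒ : ℤ}
    {η : Finset (Sym2 (meshDomain E.Ω E.δ))} (hη : η ⊆ E.interfaceGraph.edgeFinset) {j : ℕ}
    (s : Finset (Site 2)) (hcard : s.card = j) (hmem : ∀ v ∈ s, v ∈ meshDomain E.Ω E.δ)
    (h1 : ∀ v ∈ s, supLevel x₀ v = nᵢ ∧ ∃ w, supLevel x₀ w = nₒ ∧ (bandGraph E (liftConfig E.Ω E.δ η) x₀ nᵢ nₒ).Reachable v w)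
    (h2 : ∀ v ∈ s, ∀ z ∈ E.zdArcA, nᵢ < supLevel x₀ z → supLevel x₀ z < nₒ →
      ¬ (bandGraph E (liftConfig E.Ω E.δ η) x₀ nᵢ nₒ).Reachable v z)
    (h3 : (↑s : Set (Site 2)).Pairwise fun v v' ↦ ¬ (bandGraph E (liftConfig E.Ω E.δ η) x₀ nᵢ nₒ).Reachable v v') :
    (↑η : Percolation.BondConfig (meshDomain E.Ω E.δ)) ∈
      regionArmsAvoiding (bandRegion E x₀ nᵢ nₒ) (bandIn E x₀ nᵢ) (bandIn E x₀ nₒ) (bandZ E x₀ nᵢ nₒ) j := by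
  classical
  set s' : Finset (meshDomain E.Ω E.δ) := s.subtype (· ∈ meshDomain E.Ω E.δ) with hs'
  have hmem' : ∀ v : meshDomain E.Ω E.δ, v ∈ s' ↔ v.1 ∈ s := fun v ↦ by rw [hs', Finset.mem_subtype]
  refine ⟨s', ?_, ?_, ?_, ?_⟩
  · rw [hs', Finset.card_subtype, Finset.filter_true_of_mem hmem, hcard]
  · intro v hv
    obtain ⟨hlev, w, hw, hreach⟩ := h1 v.1 ((hmem' v).1 hv)
    obtain ⟨hw', hreach'⟩ := regionGraph_reachable_of_bandGraph_reachable hη v hreach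
    exact ⟨mem_bandIn.2 hlev, ⟨w, hw'⟩, mem_bandIn.2 hw, hreach'⟩
  · intro v hv z hz hreach
    obtain ⟨hzA, hz1, hz2⟩ := mem_bandZ.1 hz
    exact h2 v.1 ((hmem' v).1 hv) z.1 hzA hz1 hz2 (bandGraph_reachable_of_regionGraph_reachable hη hreach)
  · intro v hv v' hv' hvv' hreach
    rw [Finset.mem_coe] at hv hv'
    exact h3 ((hmem' v).1 hv) ((hmem' v').1 hv') (fun h ↦ hvv' (Subtype.ext h))
      (bandGraph_reachable_of_regionGraph_reachable hη hreach)

/-! ### Step B: the arm event of the band is exponentially unlikely -/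

/-- **`j` separated open arms of the band cost `(c^m)^j`.** For `0 ≤ nᵢ < nₒ`, under the
random-cluster measure of the interface graph (any `q ≥ 1`, `0 ≤ p < 1`, wired set `Bw`), the
event `regionArmsAvoiding (bandRegion) (bandIn nᵢ) (bandIn nₒ) (bandZ) j` has probability at
most `(c^m)^j`, where `m = ⌊log₃ (nₒ / (2 (nᵢ + 1)))⌋` square annuli `x₀ + S_{n,2n}`,
`n = (nᵢ+1) 3^i`, fit in the band and `c` bounds the wired crossing probability of each
(`RandomClusterMultiCrossing` + `RandomClusterRegionCrossingBound`), PROVIDED the wired set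
consists of arc-`A` sites (`Bw ⊆ val⁻¹' zdArcA`). [cite: DuminilCopinSmirnov2012Clay, Thm. 6.1 (proof, eq. (6.1)–(6.2))] -/
theorem rcMeasure_real_regionArmsAvoiding_band_le [DecidableRel E.interfaceGraph.Adj] {p q : ℝ}
    (hp : p ∈ Set.Icc (0 : ℝ) 1) (hp1 : p < 1) (hq : 1 ≤ q) {Bw : Set (meshDomain E.Ω E.δ)}
    (hBw : Bw ⊆ Subtype.val ⁻¹' E.zdArcA) (x₀ : Site 2) {nᵢ nₒ : ℤ} (hnᵢ : 0 ≤ nᵢ) (hnio : nᵢ < nₒ)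
    {c : ℝ} (hc : 0 ≤ c)
    (hcb : ∀ n : ℕ, 1 ≤ n → (rcMeasure (finsetGraph (zdGraph 2) (squareAnnulusSites n)) p q
        (squareAnnulusInner n ∪ squareAnnulusOuter n)).real
        (openCrossing Set.univ (squareAnnulusInner n) (squareAnnulusOuter n)) ≤ c) (j : ℕ) :
    (rcMeasure E.interfaceGraph p q Bw).real
        (regionArmsAvoiding (bandRegion E x₀ nᵢ nₒ) (bandIn E x₀ nᵢ) (bandIn E x₀ nₒ) (bandZ E x₀ nᵢ nₒ) j) ≤
      (c ^ Nat.log 3 (nₒ.toNat / (2 * (nᵢ.toNat + 1)))) ^ j := by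
  classical
  letI : LinearOrder (meshDomain E.Ω E.δ) :=
    LinearOrder.lift' (fun v : meshDomain E.Ω E.δ ↦ toLex (v.1 0, v.1 1)) (by
      intro v w h
      have h' := toLex.injective h
      simp only [Prod.mk.injEq] at h'
      exact Subtype.ext (funext fun k ↦ by rcases fin_two_eq_zero_or_one k with rfl | rfl <;> [exact h'.1; exact h'.2]))
  set U₀ := bandRegion E x₀ nᵢ nₒ with hU₀
  set In := bandIn E x₀ nᵢ with hIn
  set Out := bandIn E x₀ nₒ with hOut
  set Z := bandZ E x₀ nᵢ nₒ with hZ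
  set T : Set (meshDomain E.Ω E.δ) := {v | supLevel x₀ v.1 = nᵢ ∨ supLevel x₀ v.1 = nₒ} with hT
  set ι : meshDomain E.Ω E.δ ↪ Site 2 := ⟨Subtype.val, Subtype.val_injective⟩ with hι
  -- the annuli
  set n₁ : ℕ := nᵢ.toNat + 1 with hn₁
  set Qn : ℕ := nₒ.toNat / (2 * n₁) with hQn
  set m : ℕ := Nat.log 3 Qn with hm
  set ns : Fin m → ℕ := fun i ↦ n₁ * 3 ^ (i : ℕ) with hns
  have hn₁pos : 1 ≤ n₁ := by rw [hn₁]; omega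
  have hnᵢn₁ : (nᵢ : ℤ) < n₁ := by rw [hn₁]; push_cast; rw [Int.toNat_of_nonneg hnᵢ]; linarith
  have hnₒ0 : 0 ≤ nₒ := hnᵢ.trans hnio.le
  have hns1 : ∀ i : Fin m, 1 ≤ ns i := fun i ↦ by
    rw [hns]; dsimp only; exact Nat.one_le_iff_ne_zero.2 (by positivity)
  have hnsge : ∀ i : Fin m, (n₁ : ℤ) ≤ ns i := fun i ↦ by
    rw [hns]; dsimp only; push_cast
    have : (1 : ℤ) ≤ 3 ^ (i : ℕ) := one_le_pow₀ (by norm_num)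
    have hn : (0 : ℤ) ≤ n₁ := by positivity
    nlinarith
  have hns_lt : ∀ i : Fin m, 2 * (ns i : ℤ) < nₒ := by
    intro i
    have h1 : ns i * 3 ≤ n₁ * 3 ^ m := by
      rw [hns]; dsimp only
      rw [mul_assoc, ← pow_succ]
      exact Nat.mul_le_mul_left _ (Nat.pow_le_pow_right (by norm_num) i.2)
    have h2 : 3 ^ m ≤ Qn := by
      rw [hm]
      refine Nat.pow_log_le_self 3 ?_
      intro h0
      have : m = 0 := by rw [hm, h0, Nat.log_zero_right]
      exact absurd i.2 (by omega)
    have h3 : 2 * n₁ * Qn ≤ nₒ.toNat := by rw [hQn, mul_comm]; exact Nat.div_mul_le_self _ _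
    have h4 : 2 * ns i < nₒ.toNat := by
      have hns1' := hns1 i
      have : 2 * (ns i * 3) ≤ 2 * n₁ * Qn := by
        have := Nat.mul_le_mul_left 2 (h1.trans (Nat.mul_le_mul_left _ h2)); linarith [this]
      omega
    have : ((2 * ns i : ℕ) : ℤ) < (nₒ.toNat : ℤ) := by exact_mod_cast h4
    rwa [Int.toNat_of_nonneg hnₒ0, Nat.cast_mul, Nat.cast_two] at this
  have hdisjA : ∀ i i' : Fin m, i ≠ i' → ∀ z : Site 2, (ns i : ℤ) ≤ supLevel x₀ z → supLevel x₀ z ≤ 2 * ns i →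
      ¬ ((ns i' : ℤ) ≤ supLevel x₀ z ∧ supLevel x₀ z ≤ 2 * ns i') := by
    intro i i' hii' z hz1 hz2 h
    obtain ⟨h1, h2⟩ := h
    rw [hns] at hz1 hz2 h1 h2; dsimp only at hz1 hz2 h1 h2
    push_cast at hz1 hz2 h1 h2
    have key : ∀ a b : ℕ, a < b → (2 : ℤ) * (n₁ * 3 ^ a) < n₁ * 3 ^ b := by
      intro a b hab
      have h3 : (3 : ℤ) ^ a * 3 ≤ 3 ^ b := by
        rw [← pow_succ]; exact pow_le_pow_right₀ (by norm_num) hab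
      have hn : (0 : ℤ) < n₁ := by exact_mod_cast hn₁pos
      have h4 : (n₁ : ℤ) * (3 ^ a * 3) ≤ n₁ * 3 ^ b := mul_le_mul_of_nonneg_left h3 hn.le
      have h5 : (0 : ℤ) < n₁ * 3 ^ a := mul_pos hn (pow_pos (by norm_num) a)
      nlinarith [h4, h5]
    rcases lt_or_gt_of_ne (fun h : (i : ℕ) = i' ↦ hii' (Fin.ext h)) with hlt | hlt
    · have := key _ _ hlt; linarith
    · have := key _ _ hlt; linarith
  have hTA : ∀ v ∈ T, ∀ i : Fin m, ¬ ((ns i : ℤ) ≤ supLevel x₀ (ι v) ∧ supLevel x₀ (ι v) ≤ 2 * ns i) := by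
    intro v hv i h
    obtain ⟨h1, h2⟩ := h
    have hlt := hns_lt i
    have hge := hnsge i
    change supLevel x₀ v.1 = nᵢ ∨ supLevel x₀ v.1 = nₒ at hv
    change (ns i : ℤ) ≤ supLevel x₀ v.1 at h1
    change supLevel x₀ v.1 ≤ 2 * ns i at h2
    rcases hv with hv | hv <;> rw [hv] at h1 h2
    · linarith
    · linarith
  have hInA : ∀ a ∈ In, ∀ i : Fin m, supLevel x₀ (ι a) < ns i := by
    intro a ha i
    have ha' := mem_bandIn.1 ha
    change supLevel x₀ a.1 < ns i
    rw [ha']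
    linarith [hnsge i]
  have hOutA : ∀ b ∈ Out, ∀ i : Fin m, 2 * (ns i : ℤ) < supLevel x₀ (ι b) := by
    intro b hb i
    have hb' := mem_bandIn.1 hb
    change 2 * (ns i : ℤ) < supLevel x₀ b.1
    rw [hb']
    exact hns_lt i
  have hbase := rcMeasure_real_regionCrossing_inter_regionCyl_le E.interfaceGraph ι x₀ hp hp1 hq Bw T
    (fun u v h ↦ interfaceGraph_adj_zdGraph E h) U₀ (Finset.filter_subset _ _)
    ns hns1 hdisjA hTA In Out hInA hOutA hc (fun i ↦ hcb (ns i) (hns1 i))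
  -- rims: a vertex of the region with an edge of `G` leaving the region is at level `nᵢ` or `nₒ`
  have hrimA : ∀ e ∈ U₀, ∀ v ∈ e, ∀ e' ∈ E.interfaceGraph.edgeFinset, e' ∉ U₀ → v ∈ e' → v ∈ T := by
    intro e he v hv e' he' he'U hve'
    obtain ⟨-, hlev⟩ := mem_bandRegion.1 he
    obtain ⟨h1, h2⟩ := hlev v hv
    -- the other endpoint of `e'` is out of the band, at level distance `≤ 1`
    have key : ∃ w, w ∈ e' ∧ ¬ (nᵢ ≤ supLevel x₀ w.1 ∧ supLevel x₀ w.1 ≤ nₒ) := by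
      by_contra hall
      push Not at hall
      exact he'U (mem_bandRegion.2 ⟨he', fun w hw ↦ hall w hw⟩)
    obtain ⟨w, hw, hwout⟩ := key
    have hadj : E.interfaceGraph.Adj v w := by
      have hvw : v ≠ w := fun h ↦ hwout (h ▸ ⟨h1, h2⟩)
      have he'eq : e' = s(v, w) := ((Sym2.mem_and_mem_iff hvw).1 ⟨hve', hw⟩)
      rw [he'eq] at he'
      exact SimpleGraph.mem_edgeFinset.1 he'
    have hl1 := supLevel_le_of_adj x₀ (interfaceGraph_adj_zdGraph E hadj)
    have hl2 := supLevel_le_of_adj x₀ (interfaceGraph_adj_zdGraph E hadj.symm)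
    change supLevel x₀ v.1 = nᵢ ∨ supLevel x₀ v.1 = nₒ
    omega
  -- vertices of the wired set in the region: on the rims or exceptional
  have hBZA : ∀ e ∈ U₀, ∀ v ∈ e, v ∈ Bw → v ∈ T ∨ v ∈ Z := by
    intro e he v hv hvB
    obtain ⟨-, hlev⟩ := mem_bandRegion.1 he
    obtain ⟨h1, h2⟩ := hlev v hv
    by_cases hrim : supLevel x₀ v.1 = nᵢ ∨ supLevel x₀ v.1 = nₒ
    · exact Or.inl hrim
    · right
      refine mem_bandZ.2 ⟨hBw hvB, ?_, ?_⟩ <;> omega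
  have harms := rcMeasure_real_regionArmsAvoiding_inter_le E.interfaceGraph hp hq Bw T In Out Z U₀
    (θ := c ^ m) (by positivity) (fun U hU η _ _ hins ↦ hbase U hU η hins) hrimA hBZA j (E := Set.univ)
    (fun _ _ _ ↦ by simp)
  rw [Set.inter_univ] at harms
  refine harms.trans ?_
  have hq0 : 0 < q := one_pos.trans_le hq
  haveI := isProbabilityMeasure_rcMeasure E.interfaceGraph hp hq0 Bw
  rw [probReal_univ, mul_one]

/-! ### Step A: traversals put the lifted configuration in the arm event -/

/-- **Traversals of a shell force the separated-arms event of the band.** For a discrete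
Dobrushin structure `E` on the Jordan domain `D` (`E.Ω = D`) with the geometric hypotheses of
`fkArms_of_hasTraversals`, if the FK exploration polygon of the lifted configuration of
`η ⊆ E(G)` traverses `D(x; ρ, R)` `2(j + ⌊1/θ⌋₊ + 1)` times, then `η` lies in
`regionArmsAvoiding (bandRegion) (bandIn nᵢ) (bandIn nₒ) (bandZ) j`.
[cite: DuminilCopinSmirnov2012Clay, §6.1, proof of Thm. 6.1] -/
theorem mem_regionArmsAvoiding_of_hasTraversals [DecidableRel E.interfaceGraph.Adj]
    {Dm : RandomPlanarGeometry.DobrushinDomain} (hΩ : E.Ω = Dm.carrier) (hδ : 0 < E.δ)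
    {x : ℂ} {ρ R q₁ q₂ r₁ r₂ : ℝ} (hq₁pos : 0 < q₁) (hρ : 0 ≤ ρ)
    (hq₁ : ρ + 3 * E.δ < q₁) (hq₂ : q₂ + 3 * E.δ < R) (hr₁ : q₁ + ρ + 7 * E.δ ≤ r₁)
    (hr₂ : r₂ + ρ + 7 * E.δ ≤ q₂) (hr : r₁ + 40 * E.δ ≤ r₂)
    {θ : ℝ} (hθ : 0 < θ) (hmod : ∀ s t : ℝ, |s - t| < θ → dist (Dm.boundary s) (Dm.boundary t) < ρ)
    (x₀ : Site 2) {nᵢ nₒ : ℤ} (hnio : nᵢ < nₒ)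
    (hband : ∀ z : Site 2, nᵢ ≤ supLevel x₀ z → supLevel x₀ z ≤ nₒ →
      r₁ + 5 * E.δ ≤ dist (meshPoint E.δ z) x ∧ dist (meshPoint E.δ z) x ≤ r₂ - 5 * E.δ)
    (hin : ∀ z : Site 2, dist (meshPoint E.δ z) x ≤ r₁ + 4 * E.δ → supLevel x₀ z < nᵢ)
    (hout : ∀ z : Site 2, r₂ - 4 * E.δ ≤ dist (meshPoint E.δ z) x → nₒ < supLevel x₀ z)
    {j : ℕ} {η : Finset (Sym2 (meshDomain E.Ω E.δ))} (hη : η ⊆ E.interfaceGraph.edgeFinset)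
    (htr : (fkPolygon E (liftConfig E.Ω E.δ η)).HasTraversals (2 * (j + (⌊1 / θ⌋₊ + 1))) x ρ R) :
    (↑η : Percolation.BondConfig (meshDomain E.Ω E.δ)) ∈
      regionArmsAvoiding (bandRegion E x₀ nᵢ nₒ) (bandIn E x₀ nᵢ) (bandIn E x₀ nₒ) (bandZ E x₀ nᵢ nₒ) j := by
  set ω := liftConfig E.Ω E.δ η with hω
  -- the exploration is genuine (a traversal needs a non-constant polygon)
  rcases medialExploration_eq_nil_or E ω with hnil | hexp0
  · exfalso
    obtain ⟨sT, tT, htrav, -⟩ := htr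
    have hpos : 0 < 2 * (j + (⌊1 / θ⌋₊ + 1)) := by omega
    have h0 : ∀ u, (fkPolygon E ω) u = 0 := by
      intro u; rw [fkPolygon_eq, hnil]; rfl
    have h := (htrav ⟨0, hpos⟩).2
    rw [h0, h0] at h
    rcases h with ⟨h1, h2⟩ | ⟨h1, h2⟩ <;> linarith
  -- name the exploration list
  obtain ⟨a, l, hal⟩ : ∃ a l, medialExploration E ω = a :: l := by
    cases hl : medialExploration E ω with
    | nil =>
      exfalso
      rw [hl] at hexp0
      exact (hexp0.ne_nil rfl).elim
    | cons a l => exact ⟨a, l, rfl⟩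
  rw [hal] at hexp0
  have hexp : IsMedialExploration E ω (a :: l) := hexp0
  have hcurve : fkPolygon E ω = ⟨polyline ((a :: l).map (medialPoint E.δ))⟩ := by
    rw [fkPolygon_eq, hal]
  rw [hcurve] at htr
  -- the deterministic core
  obtain ⟨s, hscard, hs1, hs2, hs3⟩ := hexp.fkArms_of_hasTraversals hΩ hδ hq₁pos hρ hq₁ hq₂ hr₁ hr₂ hr hθ hmod
    x₀ hnio hband hin hout htr
  refine mem_regionArmsAvoiding_of_bandArms hη s hscard (fun v hv ↦ ?_)
    (fun v hv ↦ ⟨(hs1 v hv).1, (hs1 v hv).2.2⟩) hs2 hs3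
  obtain ⟨-, ⟨i, hi, rfl⟩, -⟩ := hs1 v hv
  exact hexp.cv_mem_meshDomain hi

end Transfer

/-! ### Arithmetic of the exponent -/

/-- **The exponent bookkeeping**: if `0 < c`, `c^j ≤ 3⁻³`, `3^(m+1) > Q ≥ R/(168ρ) - 2` and
`R ≥ 1008 ρ > 0`, then `(c^m)^j ≤ 1008³ (ρ/R)³`. [folklore] -/
theorem pow_pow_le_of_annuli {c ρ R Q : ℝ} {j m : ℕ} (hc : 0 < c) (hcj : c ^ j ≤ 1 / 27)
    (hρ : 0 < ρ) (hR : 1008 * ρ ≤ R) (hQ : R / (168 * ρ) - 2 ≤ Q) (hm : Q < (3 : ℝ) ^ (m + 1)) :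
    (c ^ m) ^ j ≤ (1008 : ℝ) ^ 3 * (ρ / R) ^ 3 := by
  have hRpos : 0 < R := by linarith
  -- `3^m > R / (1008 ρ)`
  have h3m : R / (1008 * ρ) < (3 : ℝ) ^ m := by
    have h1 : R / (168 * ρ) - 2 < 3 * (3 : ℝ) ^ m := by rw [pow_succ] at hm; linarith
    have e1 : R / (168 * ρ) = 2 * (R / (336 * ρ)) := by field_simp; ring
    have e2 : R / (1008 * ρ) = R / (336 * ρ) / 3 := by field_simp; ring
    have h2 : 3 ≤ R / (336 * ρ) := by rw [le_div_iff₀ (by positivity)]; linarith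
    rw [e2, div_lt_iff₀ (by norm_num : (0 : ℝ) < 3)]
    rw [e1] at h1
    linarith
  -- `(c^m)^j = (c^j)^m ≤ (1/27)^m = ((1/3)^m)^3`
  have hswap : (c ^ m) ^ j = (c ^ j) ^ m := by rw [← pow_mul, ← pow_mul, mul_comm]
  rw [hswap]
  have h27 : (c ^ j) ^ m ≤ (1 / 27 : ℝ) ^ m := pow_le_pow_left₀ (by positivity) hcj m
  have h13 : (1 / 27 : ℝ) ^ m = ((1 / 3 : ℝ) ^ m) ^ 3 := by
    rw [← pow_mul, mul_comm, pow_mul]; norm_num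
  have hinv : (1 / 3 : ℝ) ^ m < 1008 * (ρ / R) := by
    rw [one_div, inv_pow, inv_lt_iff_one_lt_mul₀ (by positivity)]
    have : 1008 * (ρ / R) * (3 : ℝ) ^ m > 1008 * (ρ / R) * (R / (1008 * ρ)) :=
      mul_lt_mul_of_pos_left h3m (by positivity)
    have hone : 1008 * (ρ / R) * (R / (1008 * ρ)) = 1 := by field_simp
    linarith
  calc (c ^ j) ^ m ≤ ((1 / 3 : ℝ) ^ m) ^ 3 := h27.trans h13.le
    _ ≤ (1008 * (ρ / R)) ^ 3 := pow_le_pow_left₀ (by positivity) hinv.le 3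
    _ = (1008 : ℝ) ^ 3 * (ρ / R) ^ 3 := by ring

/-! ### The traversal bound from the annulus-circuit estimate -/

/-- **(C1) for the FK-Ising interface from DCS Lemma 6.3.** The named fact
`fkInterface_traversalBound` (DCS 2012, Thm. 6.1 / eq. (6.2): the Aizenman–Burchard hypothesis
for the critical FK-Ising exploration polygon, with a shell-dependent threshold) follows from the
annulus-circuit estimate `fkIsing_annulusCrossing_le` (DCS 2012, Lemma 6.3). See the module
docstring for the proof. [cite: DuminilCopinSmirnov2012Clay, Thm. 6.1 (proof, eq. (6.1)–(6.2)) and Lemma 6.3] -/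
theorem fkInterface_traversalBound_of_annulusCrossing_le (hLemma : fkIsing_annulusCrossing_le) :
    fkInterface_traversalBound := by
  intro D E hE
  obtain ⟨c₀, hc₀1, hc₀⟩ := hLemma
  -- a crossing bound in `(0, 1)`
  set c : ℝ := max c₀ (1 / 2) with hcdef
  have hc1 : c < 1 := max_lt hc₀1 (by norm_num)
  have hcpos : 0 < c := lt_max_of_lt_right (by norm_num)
  have hcb : ∀ n : ℕ, 1 ≤ n →
      (rcMeasure (finsetGraph (zdGraph 2) (squareAnnulusSites n)) criticalFKIsingParam 2
        (squareAnnulusInner n ∪ squareAnnulusOuter n)).real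
        (openCrossing Set.univ (squareAnnulusInner n) (squareAnnulusOuter n)) ≤ c := by
    intro n hn
    have h := hc₀ n hn
    rw [fkIsingFiniteMeasure_eq_finsetGraph] at h
    exact h.trans (le_max_left _ _)
  -- `j` with `c^j ≤ 3⁻³`
  obtain ⟨j, hj⟩ : ∃ j : ℕ, c ^ j ≤ 1 / 27 := by
    obtain ⟨j, hj⟩ := exists_pow_lt_of_lt_one (show (0 : ℝ) < 1 / 27 by norm_num) hc1
    exact ⟨j, hj.le⟩
  -- boundary modulus at scale `ρ`, and the threshold
  have hmodex : ∀ ρ : ℝ, 0 < ρ → ∃ θ : ℝ, 0 < θ ∧ ∀ s t : ℝ, |s - t| < θ → dist (D.boundary s) (D.boundary t) < ρ :=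
    fun ρ hρ ↦ JordanDomain.exists_modulus D.toJordanDomain hρ
  choose! θf hθf hmodf using hmodex
  refine ⟨fun _ ρ _ ↦ 2 * (j + (⌊1 / θf ρ⌋₊ + 1)), (1008 : ℝ) ^ 3, 3, 1, by positivity, by norm_num, one_pos, ?_⟩
  rintro δ ⟨hδ0, hδ1⟩ hadm x ρ R hδρ hρR hR1
  have hρ : 0 < ρ := hδ0.trans_le hδρ
  have hRpos : 0 < R := hρ.trans hρR
  rw [show (3 : ℝ) = ((3 : ℕ) : ℝ) by norm_num, Real.rpow_natCast]
  -- the trivial regime `R < 1008 ρ`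
  by_cases hsmall : R < 1008 * ρ
  · calc _ ≤ (1 : ℝ≥0∞) := prob_le_one
      _ ≤ ENNReal.ofReal ((1008 : ℝ) ^ 3 * (ρ / R) ^ 3) := by
        rw [← ENNReal.ofReal_one]
        apply ENNReal.ofReal_le_ofReal
        have h1 : 1 ≤ 1008 * (ρ / R) := by
          rw [mul_div_assoc', le_div_iff₀ hRpos]; linarith
        calc (1 : ℝ) = 1 ^ 3 := by norm_num
          _ ≤ (1008 * (ρ / R)) ^ 3 := pow_le_pow_left₀ zero_le_one h1 3
          _ = _ := by ring
  push Not at hsmall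
  /- the main regime: notation -/
  set E' := E δ with hE'
  have hΩ : E'.Ω = D.carrier := hE.Ω_eq δ
  have hδ' : E'.δ = δ := hE.δ_eq δ
  have hδpos : 0 < E'.δ := by rw [hδ']; exact hδ0
  have hΩb : Bornology.IsBounded E'.Ω := by rw [hΩ]; exact D.isBounded
  letI instF : Fintype (meshDomain E'.Ω E'.δ) := (meshDomain_finite hΩb hδpos).fintype
  letI instD : DecidableRel E'.interfaceGraph.Adj := Classical.decRel _
  -- radii and levels
  set r₁ : ℝ := 13 * ρ with hr₁
  set r₂ : ℝ := R / 2 - 8 * ρ with hr₂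
  set x₀ : Site 2 := nearSite δ x with hx₀
  set nᵢ : ℤ := ⌊(r₁ + 6 * δ) / δ⌋ + 1 with hnᵢ
  set nₒ : ℤ := ⌊(r₂ - 4 * δ) / (2 * δ)⌋ - 2 with hnₒ
  have hfl₁ := Int.floor_le ((r₁ + 6 * δ) / δ)
  have hfl₁' := Int.lt_floor_add_one ((r₁ + 6 * δ) / δ)
  have hfl₂ := Int.floor_le ((r₂ - 4 * δ) / (2 * δ))
  have hfl₂' := Int.lt_floor_add_one ((r₂ - 4 * δ) / (2 * δ))
  have hnᵢ_real : (r₁ + 6 * δ) / δ < nᵢ ∧ (nᵢ : ℝ) ≤ (r₁ + 6 * δ) / δ + 1 := by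
    rw [hnᵢ]; push_cast; constructor <;> linarith
  have hnₒ_real : (r₂ - 4 * δ) / (2 * δ) - 3 < nₒ ∧ (nₒ : ℝ) ≤ (r₂ - 4 * δ) / (2 * δ) - 2 := by
    rw [hnₒ]; push_cast; constructor <;> linarith
  have hδne : δ ≠ 0 := hδ0.ne'
  have hρδ : 1 ≤ ρ / δ := by rw [le_div_iff₀ hδ0]; linarith
  have e1 : (r₁ + 6 * δ) / δ = 13 * (ρ / δ) + 6 := by rw [hr₁]; field_simp
  have e2 : (r₂ - 4 * δ) / (2 * δ) = R / (4 * δ) - 4 * (ρ / δ) - 2 := by rw [hr₂]; field_simp; ring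
  -- the level/distance dictionary
  have hin : ∀ z : Site 2, dist (meshPoint δ z) x ≤ r₁ + 4 * δ → supLevel x₀ z < nᵢ := by
    intro z hz
    have h := mul_supLevel_le_dist_add hδ0 x z
    rw [← hx₀] at h
    have h' : (supLevel x₀ z : ℝ) ≤ (r₁ + 6 * δ) / δ := by
      rw [le_div_iff₀ hδ0]; linarith
    exact_mod_cast h'.trans_lt hnᵢ_real.1
  have hout : ∀ z : Site 2, r₂ - 4 * δ ≤ dist (meshPoint δ z) x → nₒ < supLevel x₀ z := by
    intro z hz
    have h := dist_le_two_mul_supLevel hδ0 x z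
    rw [← hx₀] at h
    have h' : (r₂ - 4 * δ) / (2 * δ) - 1 ≤ supLevel x₀ z := by
      rw [sub_le_iff_le_add, div_le_iff₀ (by positivity)]; linarith
    have : (nₒ : ℝ) < supLevel x₀ z := by linarith [hnₒ_real.2]
    exact_mod_cast this
  have hband : ∀ z : Site 2, nᵢ ≤ supLevel x₀ z → supLevel x₀ z ≤ nₒ →
      r₁ + 5 * δ ≤ dist (meshPoint δ z) x ∧ dist (meshPoint δ z) x ≤ r₂ - 5 * δ := by
    intro z h1 h2
    have h1' : (nᵢ : ℝ) ≤ supLevel x₀ z := by exact_mod_cast h1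
    have h2' : (supLevel x₀ z : ℝ) ≤ nₒ := by exact_mod_cast h2
    have hlo := mul_supLevel_le_dist_add hδ0 x z
    have hhi := dist_le_two_mul_supLevel hδ0 x z
    rw [← hx₀] at hlo hhi
    constructor
    · have : (r₁ + 6 * δ) / δ < supLevel x₀ z := hnᵢ_real.1.trans_le h1'
      rw [div_lt_iff₀ hδ0] at this
      linarith
    · have : (supLevel x₀ z : ℝ) ≤ (r₂ - 4 * δ) / (2 * δ) - 2 := h2'.trans hnₒ_real.2
      rw [le_sub_iff_add_le, le_div_iff₀ (by positivity)] at this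
      linarith
  have hR' : 252 * (ρ / δ) ≤ R / (4 * δ) := by
    rw [show 252 * (ρ / δ) = (1008 * ρ) / (4 * δ) by field_simp; ring]
    gcongr
  have hnio : nᵢ < nₒ := by
    have : (nᵢ : ℝ) < nₒ := by
      have h1 := hnᵢ_real.2; have h2 := hnₒ_real.1
      rw [e1] at h1; rw [e2] at h2
      linarith
    exact_mod_cast this
  have hnᵢ0 : 0 ≤ nᵢ := by
    have : (0 : ℝ) < nᵢ := by
      have h1 := hnᵢ_real.1
      rw [e1] at h1
      linarith
    exact_mod_cast this.le
  /- the probability as a random-cluster probability of the interface graph -/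
  set Trav : Set (Percolation.BondConfig (Site 2)) :=
    {ω | (fkPolygon E' ω).HasTraversals (2 * (j + (⌊1 / θf ρ⌋₊ + 1))) x ρ R} with hTrav
  change fkDobrushinMeasure E' Trav ≤ _
  rw [← ofReal_measureReal]
  apply ENNReal.ofReal_le_ofReal
  rw [fkDobrushinMeasure_real_eq E' hΩb hδpos Trav]
  have hp := criticalFKIsingParam_mem_Icc
  -- Step A: traversals put the configuration in the arm event
  have hincl : ∀ η : Finset (Sym2 (meshDomain E'.Ω E'.δ)), η ⊆ E'.interfaceGraph.edgeFinset →
      (↑η : Percolation.BondConfig (meshDomain E'.Ω E'.δ)) ∈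
        {ω : Percolation.BondConfig (meshDomain E'.Ω E'.δ) | Sym2.map Subtype.val '' ω ∈ Trav} →
      (↑η : Percolation.BondConfig (meshDomain E'.Ω E'.δ)) ∈
        regionArmsAvoiding (bandRegion E' x₀ nᵢ nₒ) (bandIn E' x₀ nᵢ) (bandIn E' x₀ nₒ) (bandZ E' x₀ nᵢ nₒ) j := by
    intro η hη hηT
    have htr : (fkPolygon E' (liftConfig E'.Ω E'.δ η)).HasTraversals (2 * (j + (⌊1 / θf ρ⌋₊ + 1))) x ρ R := hηT
    refine mem_regionArmsAvoiding_of_hasTraversals hΩ hδpos (x := x) (ρ := ρ) (R := R) (q₁ := 5 * ρ) (q₂ := R / 2)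
      (r₁ := r₁) (r₂ := r₂) (by linarith) hρ.le (by rw [hδ']; linarith) (by rw [hδ']; linarith)
      (by rw [hδ', hr₁]; linarith) (by rw [hδ', hr₂]; linarith) (by rw [hδ', hr₁, hr₂]; linarith)
      (hθf ρ hρ) (hmodf ρ hρ) x₀ hnio (by rw [hδ']; exact hband) (by rw [hδ']; exact hin)
      (by rw [hδ']; exact hout) hη htr
  refine (rcMeasure_real_mono_on_edgeFinset E'.interfaceGraph hp two_pos (Subtype.val ⁻¹' E'.zdArcA) hincl).trans ?_
  -- Step B: the arm event costs `(c^m)^j`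
  refine (rcMeasure_real_regionArmsAvoiding_band_le hp criticalFKIsingParam_lt_one (by norm_num : (1 : ℝ) ≤ 2)
    subset_rfl x₀ hnᵢ0 hnio hcpos.le hcb j).trans ?_
  -- Step C: the exponent
  set n₁ : ℕ := nᵢ.toNat + 1 with hn₁
  set Qn : ℕ := nₒ.toNat / (2 * n₁) with hQn
  have hnₒ0 : 0 ≤ nₒ := hnᵢ0.trans hnio.le
  refine pow_pow_le_of_annuli hcpos hj hρ hsmall ?_ ?_ (Q := (Qn : ℝ)) (m := Nat.log 3 Qn)
  · -- `Qn ≥ R/(168 ρ) - 2`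
    have h1 : (nₒ.toNat : ℝ) < 2 * n₁ * (Qn + 1) := by
      have := Nat.lt_mul_div_succ nₒ.toNat (show 0 < 2 * n₁ by omega)
      rw [← hQn] at this
      exact_mod_cast this
    have h2 : (nₒ.toNat : ℝ) = nₒ := by
      have : ((nₒ.toNat : ℤ) : ℝ) = (nₒ : ℝ) := by rw [Int.toNat_of_nonneg hnₒ0]
      exact_mod_cast this
    have h3 : (n₁ : ℝ) = nᵢ + 1 := by
      rw [hn₁]; push_cast
      have h' : ((nᵢ.toNat : ℤ) : ℝ) = (nᵢ : ℝ) := by rw [Int.toNat_of_nonneg hnᵢ0]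
      have h'' : (nᵢ.toNat : ℝ) = nᵢ := by exact_mod_cast h'
      rw [h'']
    rw [h2, h3] at h1
    have hnᵢle : (nᵢ : ℝ) + 1 ≤ 21 * (ρ / δ) := by
      have := hnᵢ_real.2
      rw [e1] at this
      linarith
    have hnₒge : R / (4 * δ) - 9 * (ρ / δ) ≤ nₒ := by
      have := hnₒ_real.1
      rw [e2] at this
      linarith
    have hQ0 : (0 : ℝ) ≤ Qn := Nat.cast_nonneg _
    have h4 : R / (4 * δ) - 9 * (ρ / δ) < 2 * (21 * (ρ / δ)) * (Qn + 1) := by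
      have : 2 * ((nᵢ : ℝ) + 1) * (Qn + 1) ≤ 2 * (21 * (ρ / δ)) * (Qn + 1) := by nlinarith
      linarith
    have hρδpos : 0 < ρ / δ := by positivity
    have e3 : R / (4 * δ) = (R / (4 * ρ)) * (ρ / δ) := by field_simp
    rw [e3] at h4
    have h5 : R / (4 * ρ) - 9 < 42 * ((Qn : ℝ) + 1) := by
      by_contra hcon
      push Not at hcon
      have : (42 * ((Qn : ℝ) + 1)) * (ρ / δ) ≤ (R / (4 * ρ) - 9) * (ρ / δ) :=
        mul_le_mul_of_nonneg_right hcon hρδpos.le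
      nlinarith
    have e4 : R / (168 * ρ) = R / (4 * ρ) / 42 := by field_simp; ring
    rw [e4]
    linarith
  · exact_mod_cast Nat.lt_pow_succ_log_self (show 1 < 3 by norm_num) Qn

/-- **(C1) for the FK-Ising interface from the RSW bound.** Composing with
`fkIsing_annulusCrossing_le_of_fkIsing_rsw` (DCS 2012, Lemma 6.3 from Thm. 3.16): the named fact
`fkInterface_traversalBound` follows from the RSW-type bound `fkIsing_rsw` (Duminil-Copin–Hongler–Nolin
2011 / DCS 2012, Thm. 3.16), the one remaining unproved input of this chain.
[cite: DuminilCopinSmirnov2012Clay, Thm. 6.1 and Thm. 3.16] -/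
theorem fkInterface_traversalBound_of_fkIsing_rsw (hrsw : fkIsing_rsw) : fkInterface_traversalBound :=
  fkInterface_traversalBound_of_annulusCrossing_le (fkIsing_annulusCrossing_le_of_fkIsing_rsw hrsw)

end Literature.Probability.LatticeModels

end
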